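import Literature.Geometry.Lorentzian.ADMTailClassInhabited
import Literature.Geometry.Lorentzian.QuasiFinalLabelOrientation
import Literature.Geometry.Lorentzian.MinkowskiCauchy
import Literature.Geometry.Lorentzian.MinkowskiCauchyDevelopment
import HarnessLib

/-!
# Minkowski spacetime `(ℝ⁴, η, ∂ₜ)` inhabits the typed quasi-final late-chart clauses (Ellithy 2026, Def. 4.4; §4.1)

A. Ellithy, *The spacetime Penrose inequality under a quasi final state hypothesis*,
arXiv:2605.18730 (2026), Definition 4.4 (p. 39), §4.1 (p. 38), Remark 4.6 (p. 40: "the hypothesis is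
modeled on the expected late-time behavior of black-hole exteriors: … convergence to a stationary
exterior"; the flat model `m = 0` is the degenerate stationary exterior); B. O'Neill,
*Semi-Riemannian geometry*, 1983, Ch. 14, Def. 14.28 and p. 415 ("In `ℝⁿ₁` the hyperplanes
`t` constant are Cauchy hypersurfaces").

`ADMTailClassInhabited` (§ Minkowski) shows that the CARTESIAN MODEL `(ℝ × E3, η)` with its polar chart
inhabits `IsQuasiFinalAnalytic` / `HasUniformCollarControl`.  This module transports that to the
tree's Minkowski SPACETIME `Minkowski.spacetime : Spacetime 4` — carrier `E4 = ℝ⁴`, metric `η`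
(`Minkowski.bilin`), time orientation `∂ₜ`, model `𝓘(ℝ, E4) = 𝓡 4` — i.e. to the exact signature in
which development-level statements quantify (`LorentzianMetric (𝓡 4) ∞ _`, `TimeOrientation`), and
adds the ORIENTATION clause of §4.1, which needs a genuine time-oriented Lorentzian manifold:

* `TailClassModel.toE4 : ℝ × E3 →L[ℝ] E4`, `(t, y) ↦ (t, y)`; the late chart
  `Minkowski.lateChart (t, r, p) = (t, r p) ∈ E4`; off the axis `Φ ∘ polar = toE4`
  (`Minkowski.polarChart_lateChart_eq`), so the chart metric is `η ∘ (toE4 × toE4) = η_{ℝ×E3}`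
  (`Minkowski.pullbackBilin_lateChart`), the ADM form of the flat tuple (`Minkowski.metric_hasADMForm`
  for the analytic metric `Minkowski.metric` on `E4`, model `𝓘(ℝ, E4)`; `Minkowski.spacetime_hasADMForm`
  for the bundled `Minkowski.spacetime`, model `𝓡 4`, by `rfl`-transport `spacetime_metric_val`);
* `Minkowski.metric_isQuasiFinalAnalytic` / `metric_hasUniformCollarControl` /
  `metric_isQuasiFinalAnalyticCollar` and their bundled forms `Minkowski.spacetime_isQuasiFinalAnalytic`
  / `spacetime_hasUniformCollarControl` / `spacetime_isQuasiFinalAnalyticCollar` (Def. 4.4 (1)+(2),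
  §4.1 rest frame, collar sentence), every `r₀ > 0`, `T̲`;
* `Minkowski.isCauchyHypersurface_level_time c`: EVERY level `{t* = c}` is a Cauchy hypersurface
  (O'Neill loc. cit.; the tree's `Minkowski.isCauchyHypersurface_range_sliceEmbed` is the level `0`),
  `Minkowski.spacetime_isCauchyTemporalFunction_time`: `t*` is a Cauchy temporal function, and
  `Minkowski.spacetime_isQuasiFinalTemporalChart`: the late chart's time is `t*`
  (`IsQuasiFinalTemporalChart`, the §4.1 orientation clause as typed in `QuasiFinalTemporalChart`);
* end-to-end check of the chain typed in `ADMTailLabelLines` / `QuasiFinalLabelOrientation`: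
  `Minkowski.spacetime_labelLine_isFutureTimelikeCurveOn` — far label lines `u ↦ (u, r p)` of the flat
  late chart are future-directed timelike curves with `η(γ̇, γ̇) ≤ -c₀`.

* § Development level: the same statements over the tree's genuine Cauchy development carried by
  Minkowski spacetime, `Minkowski.vacuumCauchyDevelopment : VacuumCauchyDevelopment trivialData`
  (`MinkowskiCauchyDevelopment`; every field a theorem, `toSpacetime = spacetime` by `rfl`) — the
  signature `(𝒟.carrier, 𝒟.metric, 𝒟.timeOrientation)`, `𝒟 : CauchyDevelopment _`, in which
  development-level hypotheses on late exterior charts are stated: `Minkowski.dev_isQuasiFinalAnalytic`,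
  `dev_hasUniformCollarControl`, `dev_isQuasiFinalAnalyticCollar`, `dev_hasADMForm`,
  `dev_isQuasiFinalTemporalChart`, `dev_isCauchyHypersurface_level_time`,
  `dev_labelLine_isFutureTimelikeCurveOn` (all by `rfl`-transport of the `spacetime_*` theorems).  The
  older vendored `Minkowski.development` (over the hypothesis class `Minkowski.DevelopmentFacts`, refuted
  in-tree by `Minkowski.not_developmentFacts`) is NOT used.

Non-vacuity of a hypothesis class proves nothing about any summit; no facts are introduced.

## References

* [Ellithy2026] A. Ellithy, arXiv:2605.18730 (2026), Def. 4.4 (p. 39), §4.1 (p. 38), Rem. 4.6 (p. 40).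
* [ONeillSemiRiemannian1983] B. O'Neill, *Semi-Riemannian geometry*, Academic Press 1983, Ch. 14,
  Def. 14.28 (p. 415).
-/

noncomputable section

open Set Metric Function Filter
open scoped Manifold ContDiff Topology InnerProductSpace

namespace Literature.Geometry.Lorentzian

namespace TailClassModel

/-- The linear identification `ℝ × E3 ≅ E4`, `(t, y) ↦ (t, y⁰, y¹, y²)` (`E4.ofTimeSpace` as a
continuous linear map). [folklore] -/
def toE4 : ℝ × E3 →L[ℝ] E4 :=
  LinearMap.toContinuousLinearMap
    { toFun := fun q ↦ E4.ofTimeSpace q.1 q.2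
      map_add' := fun q q' ↦ by
        ext i
        refine Fin.cases ?_ (fun j ↦ ?_) i <;> simp
      map_smul' := fun c q ↦ by
        ext i
        refine Fin.cases ?_ (fun j ↦ ?_) i <;> simp }

/-- `toE4 (t, y) = (t, y)` (coordinate bookkeeping `(t*, x)` of `ℝ⁴`, DR arXiv:0811.0354 §5.1 as in
`E4.ofTimeSpace`). [cite: Ellithy2026, §3.1 p. 21] -/
@[simp] theorem toE4_apply (q : ℝ × E3) : toE4 q = E4.ofTimeSpace q.1 q.2 := rfl

/-- `η_{E4}(toE4 v, toE4 w) = η_{ℝ×E3}(v, w) = -v⁰ w⁰ + ⟪v', w'⟫`. [cite: Ellithy2026, §3.1 p. 21] -/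
theorem bilin_toE4 (v w : ℝ × E3) : Minkowski.bilin (toE4 v) (toE4 w) = minkForm v w := by
  rw [toE4_apply, toE4_apply, Minkowski.bilin_apply, minkForm_apply]
  simp only [E4.ofTimeSpace_apply_zero, E4.ofTimeSpace_apply_succ]
  congr 1
  rw [PiLp.inner_apply]
  exact Finset.sum_congr rfl fun i _ ↦ by simp [mul_comm]

end TailClassModel

namespace Minkowski

open TailClassModel

/-- **The late polar chart of Minkowski spacetime**: `Φ(t, r, p) = (t, r p) ∈ ℝ⁴` (the flat model of
the late rest-frame chart of Def. 4.4, p. 39). [cite: Ellithy2026, Def. 4.4 p. 39] -/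
def lateChart : ℝ × ℝ × sphere (0 : E3) 1 → E4 := fun q ↦ E4.ofTimeSpace q.1 (q.2.1 • (q.2.2 : E3))

/-- `lateChart = toE4 ∘ ((t, r, p) ↦ (t, r p))`. [cite: Ellithy2026, Def. 4.4 p. 39] -/
theorem lateChart_eq_comp : lateChart = toE4 ∘ minkPolarChart := rfl

/-- Off the axis the chart read in Cartesian slice coordinates is `toE4`:
`(t, y) ↦ (t, |y| · y/|y|) = (t, y)`. [cite: Ellithy2026, §3.1 p. 20] -/
theorem polarChart_lateChart_eq {q : ℝ × E3} (hq : q.2 ≠ 0) : polarChart lateChart q = toE4 q := by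
  have h := polarChart_minkPolarChart_eq hq
  simp only [polarChart] at h ⊢
  rw [lateChart_eq_comp, Function.comp_apply, h]

/-- **The chart metric of Minkowski space `(E4, η)` in its late chart is `η_{ℝ×E3}`** off the axis
`y = 0`: `(Φ∘polar)^* η = η ∘ (toE4 × toE4) = -dt² + δ`. [cite: Ellithy2026, Def. 4.4 p. 39] -/
theorem pullbackBilin_lateChart {q : ℝ × E3} (hq : q.2 ≠ 0) :
    pullbackBilin (I := 𝓘(ℝ, E4)) (I' := 𝓘(ℝ, ℝ × E3)) (polarChart lateChart) Minkowski.metric.val q =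
      minkForm := by
  have hopen : IsOpen {q' : ℝ × E3 | q'.2 ≠ 0} := isOpen_ne_fun continuous_snd continuous_const
  have hev : polarChart lateChart =ᶠ[𝓝 q] (toE4 : ℝ × E3 → E4) :=
    Filter.eventuallyEq_of_mem (hopen.mem_nhds hq) fun q' hq' ↦ polarChart_lateChart_eq hq'
  have hd : mfderiv 𝓘(ℝ, ℝ × E3) 𝓘(ℝ, E4) (polarChart lateChart) q = toE4 := by
    rw [hev.mfderiv_eq, mfderiv_eq_fderiv, ContinuousLinearMap.fderiv]
  refine ContinuousLinearMap.ext fun v ↦ ContinuousLinearMap.ext fun w ↦ ?_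
  rw [pullbackBilin_apply]
  change bilin (mfderiv 𝓘(ℝ, ℝ × E3) 𝓘(ℝ, E4) (polarChart lateChart) q v)
      (mfderiv 𝓘(ℝ, ℝ × E3) 𝓘(ℝ, E4) (polarChart lateChart) q w) = minkForm v w
  rw [hd]
  exact bilin_toE4 v w

/-- **Minkowski space `(E4, η)` has the ADM form of the flat tuple in its late chart** (Def. 4.4 (1),
the ADM-form clause: `N = 1`, `β = 0`, `g(t) = δ`), for every `r₀ ≥ 0` and `T̲` (model
`𝓘(ℝ, E4) = 𝓡 4`, the analytic metric `Minkowski.metric`). [cite: Ellithy2026, Def. 4.4 p. 39] -/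
theorem metric_hasADMForm {r₀ : ℝ} (hr₀ : 0 ≤ r₀) (Tlo : ℝ) :
    HasADMForm 𝓘(ℝ, E4) Minkowski.metric.val lateChart Tlo r₀ flat := by
  intro t y _ hy
  have hy0 : y ≠ 0 := by
    intro h; rw [h, norm_zero] at hy; exact absurd hy (not_lt.mpr hr₀)
  rw [pullbackBilin_lateChart (q := (t, y)) hy0, flat_admForm t hy0]

/-- **Minkowski space `(E4, η)` satisfies the typed analytic clauses of the quasi final state
hypothesis** `IsQuasiFinalAnalytic` — Def. 4.4 (1) (ADM form with tuple in `𝒞𝒮♯_{-τ}`) + (2) (gauge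
reducibility, forcing decay) + §4.1 (rest frame) — in its late chart `(t, r, p) ↦ (t, r p)`, for every
`r₀ > 0` and `T̲` (witnesses `α = 1/2`, `τ = 3/4`, the flat tuple; the geometric horizon clauses of
Def. 4.4 are not part of this predicate). [cite: Ellithy2026, Def. 4.4 p. 39] -/
theorem metric_isQuasiFinalAnalytic {r₀ : ℝ} (hr₀ : 0 < r₀) (Tlo : ℝ) :
    IsQuasiFinalAnalytic 𝓘(ℝ, E4) Minkowski.metric.val lateChart Tlo r₀ :=
  ⟨hr₀, 1 / 2, ⟨by norm_num, by norm_num⟩, 3 / 4, ⟨by norm_num, by norm_num⟩, flat,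
    metric_hasADMForm hr₀.le Tlo, flat_isSharpTailCoeff hr₀.le _ _ Tlo,
    flat_isGaugeReducible hr₀.le _ _ Tlo, flat_hasLateForcingDecay hr₀.le _ _ Tlo, flat_isRestFrame Tlo⟩

/-- **Minkowski space `(E4, η)` has uniform `C²` control on every collar** of its late chart (the
collar sentence of Def. 4.4 (1) as typed in `QuasiFinalCollarControl`: `G ≡ η`, `C = ‖η‖`, `c = 1`),
for every `r₀ > 0` and `T̲`. [cite: Ellithy2026, Def. 4.4 p. 39] -/
theorem metric_hasUniformCollarControl {r₀ : ℝ} (hr₀ : 0 < r₀) (Tlo : ℝ) :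
    HasUniformCollarControl 𝓘(ℝ, E4) Minkowski.metric.val lateChart Tlo r₀ := by
  intro r₁ _
  refine ⟨Tlo, r₀ / 2, ‖minkForm‖, 1, le_rfl, by positivity, one_pos, fun _ ↦ minkForm,
    contDiffOn_const, fun q hq ↦ ?_, fun q _ k _ ↦ ?_, fun q _ v ↦ norm_le_norm_minkForm v⟩
  · have hq2 : q.2 ≠ 0 := by
      intro h; have := hq.2.1; rw [h, norm_zero] at this; linarith
    exact (pullbackBilin_lateChart hq2).symm
  · rcases Nat.eq_zero_or_pos k with rfl | hk0
    · rw [norm_iteratedFDeriv_zero]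
    · rw [iteratedFDeriv_const_of_ne (Nat.pos_iff_ne_zero.mp hk0)]
      simp only [Pi.zero_apply, norm_zero]; positivity

/-- Hence Minkowski space `(E4, η)` inhabits `IsQuasiFinalAnalyticCollar` (Def. 4.4 (1)+(2), §4.1,
with the collar sentence), `r₀ > 0`. [cite: Ellithy2026, Def. 4.4 p. 39] -/
theorem metric_isQuasiFinalAnalyticCollar {r₀ : ℝ} (hr₀ : 0 < r₀) (Tlo : ℝ) :
    IsQuasiFinalAnalyticCollar 𝓘(ℝ, E4) Minkowski.metric.val lateChart Tlo r₀ :=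
  ⟨metric_isQuasiFinalAnalytic hr₀ Tlo, metric_hasUniformCollarControl hr₀ Tlo⟩

/-! ### The same for the bundled spacetime `Minkowski.spacetime : Spacetime 4` (carrier, `𝓡 4`,
smoothness `∞`) — the signature in which development-level statements are phrased -/

/-- The metric of the bundled Minkowski spacetime is that of Minkowski space (`ofLE` does not change
the sections). [cite: ONeillSemiRiemannian1983, Ch. 3 p. 55] -/
theorem spacetime_metric_val : spacetime.metric.val = Minkowski.metric.val := rfl

/-- **Minkowski spacetime has the ADM form of the flat tuple in its late chart**, `r₀ ≥ 0`
(bundled form, model `𝓡 4`, carrier `Minkowski.spacetime.carrier = E4`).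
[cite: Ellithy2026, Def. 4.4 p. 39] -/
theorem spacetime_hasADMForm {r₀ : ℝ} (hr₀ : 0 ≤ r₀) (Tlo : ℝ) :
    HasADMForm (𝓡 4) (M := spacetime.carrier) spacetime.metric.val lateChart Tlo r₀ flat :=
  metric_hasADMForm hr₀ Tlo

/-- **Minkowski spacetime satisfies `IsQuasiFinalAnalytic`** in its late chart, every `r₀ > 0`, `T̲`
(bundled form). [cite: Ellithy2026, Def. 4.4 p. 39] -/
theorem spacetime_isQuasiFinalAnalytic {r₀ : ℝ} (hr₀ : 0 < r₀) (Tlo : ℝ) :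
    IsQuasiFinalAnalytic (𝓡 4) (M := spacetime.carrier) spacetime.metric.val lateChart Tlo r₀ :=
  metric_isQuasiFinalAnalytic hr₀ Tlo

/-- **Minkowski spacetime has uniform collar control** in its late chart, every `r₀ > 0`, `T̲`
(bundled form). [cite: Ellithy2026, Def. 4.4 p. 39] -/
theorem spacetime_hasUniformCollarControl {r₀ : ℝ} (hr₀ : 0 < r₀) (Tlo : ℝ) :
    HasUniformCollarControl (𝓡 4) (M := spacetime.carrier) spacetime.metric.val lateChart Tlo r₀ :=
  metric_hasUniformCollarControl hr₀ Tlo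

/-- **Minkowski spacetime inhabits `IsQuasiFinalAnalyticCollar`**, every `r₀ > 0`, `T̲` (bundled
form). [cite: Ellithy2026, Def. 4.4 p. 39] -/
theorem spacetime_isQuasiFinalAnalyticCollar {r₀ : ℝ} (hr₀ : 0 < r₀) (Tlo : ℝ) :
    IsQuasiFinalAnalyticCollar (𝓡 4) (M := spacetime.carrier) spacetime.metric.val lateChart Tlo r₀ :=
  metric_isQuasiFinalAnalyticCollar hr₀ Tlo

/-! ### The orientation clause of §4.1: `t*` is a Cauchy temporal function and the chart time is `t*` -/

/-- `t* = pr₀` as a function on `E4`. [folklore] -/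
private theorem time_eq_proj :
    (E4.time : E4 → ℝ) = fun x ↦ (EuclideanSpace.proj (𝕜 := ℝ) (0 : Fin 4)) x := by
  funext x; rfl

/-- `t*` is smooth. [cite: ONeillSemiRiemannian1983, Ch. 14 p. 415] -/
theorem contMDiff_time : ContMDiff 𝓘(ℝ, E4) 𝓘(ℝ, ℝ) ∞ E4.time := by
  rw [contMDiff_iff_contDiff, time_eq_proj]
  exact (EuclideanSpace.proj (𝕜 := ℝ) (0 : Fin 4)).contDiff

/-- `dt*(v) = v⁰`. [cite: ONeillSemiRiemannian1983, Ch. 14 p. 415] -/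
theorem mfderiv_time_apply (x v : E4) : mfderiv 𝓘(ℝ, E4) 𝓘(ℝ, ℝ) E4.time x v = v 0 := by
  rw [mfderiv_eq_fderiv, time_eq_proj, (EuclideanSpace.proj (𝕜 := ℝ) (0 : Fin 4)).fderiv]
  rfl

/-- **`t*` is a temporal function of Minkowski spacetime**: smooth, and `dt*(v) = v⁰ > 0` on every
future-directed causal `v` (`η(∂ₜ, v) = -v⁰ < 0`). [cite: ONeillSemiRiemannian1983, Ch. 14 p. 415] -/
theorem spacetime_isTemporalFunction_time :
    spacetime.metric.IsTemporalFunction spacetime.timeOrientation E4.time := by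
  refine ⟨contMDiff_time, fun x v hv ↦ ?_⟩
  set w : E4 := v with hw
  have h := hv.2
  change bilin (E4.basisVector 0) w < 0 at h
  rw [bilin_basisVector_zero_left] at h
  exact lt_of_lt_of_eq (by linarith : (0 : ℝ) < w 0) (mfderiv_time_apply x w).symm

/-- **Every level `{t* = c}` of Minkowski spacetime is a Cauchy hypersurface** (O'Neill 1983, Ch. 14,
Def. 14.28 and p. 415: "In `ℝⁿ₁` the hyperplanes `t` constant are Cauchy hypersurfaces"): along an
endless timelike curve the time coordinate is continuous, strictly increasing and unbounded in both
directions (`Minkowski.strictMonoOn_time`, `not_bddAbove_time`, `not_bddBelow_time`), so it takes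
the value `c` exactly once. The tree's `isCauchyHypersurface_range_sliceEmbed` is the level `c = 0`.
[cite: ONeillSemiRiemannian1983, Ch. 14, Def. 14.28 (p. 415)] -/
theorem isCauchyHypersurface_level_time (c : ℝ) :
    spacetime.metric.IsCauchyHypersurface spacetime.timeOrientation (E4.time ⁻¹' {c}) := by
  change ∀ (γ : ℝ → E4) (s : Set ℝ),
    spacetime.metric.IsEndlessTimelikeCurve spacetime.timeOrientation γ s →
      ∃! t, t ∈ s ∧ γ t ∈ E4.time ⁻¹' {c}
  intro γ s hγ
  obtain ⟨hs, h, hfut, hpast⟩ := hγ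
  have hmono := strictMonoOn_time hs h
  obtain ⟨a, ha, hac⟩ : ∃ a ∈ s, γ a 0 < c := by
    obtain ⟨_, ⟨a, ha, rfl⟩, hlt⟩ := not_bddBelow_iff.mp (not_bddBelow_time hs h hpast) c
    exact ⟨a, ha, hlt⟩
  obtain ⟨b, hb, hbc⟩ : ∃ b ∈ s, c < γ b 0 := by
    obtain ⟨_, ⟨b, hb, rfl⟩, hlt⟩ := not_bddAbove_iff.mp (not_bddAbove_time hs h hfut) c
    exact ⟨b, hb, hlt⟩
  obtain ⟨σ, hσ, hσc⟩ : ∃ σ ∈ s, γ σ 0 = c :=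
    hs.isPreconnected.intermediate_value ha hb (continuousOn_time h) ⟨hac.le, hbc.le⟩
  refine ⟨σ, ⟨hσ, ?_⟩, ?_⟩
  · simpa [E4.time_apply] using hσc
  · rintro t ⟨ht, htc⟩
    have htc' : γ t 0 = c := by simpa [E4.time_apply] using htc
    exact hmono.injOn ht hσ (htc'.trans hσc.symm)

/-- **`t*` is a Cauchy temporal function of Minkowski spacetime** (Bernal–Sánchez's notion as typed in
`QuasiFinalTemporalChart`). [cite: ONeillSemiRiemannian1983, Ch. 14, Def. 14.28 (p. 415)] -/
theorem spacetime_isCauchyTemporalFunction_time :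
    spacetime.metric.IsCauchyTemporalFunction spacetime.timeOrientation E4.time :=
  ⟨spacetime_isTemporalFunction_time, isCauchyHypersurface_level_time⟩

/-- The late chart's time coordinate is `t*`: `t*(t, r p) = t`. [cite: Ellithy2026, §4.1 p. 38] -/
theorem isChartTime_lateChart (Tlo r₀ : ℝ) : IsChartTime E4.time lateChart Tlo r₀ :=
  fun _ _ _ _ ↦ rfl

/-- **Minkowski spacetime with its late chart satisfies the typed orientation clause of §4.1**
(`IsQuasiFinalTemporalChart`: the chart time is the Cauchy temporal function `t*`), every `T̲`, `r₀`.
[cite: Ellithy2026, §4.1 p. 38] -/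
theorem spacetime_isQuasiFinalTemporalChart (Tlo r₀ : ℝ) :
    IsQuasiFinalTemporalChart spacetime.metric spacetime.timeOrientation E4.time lateChart Tlo r₀ :=
  ⟨spacetime_isCauchyTemporalFunction_time, isChartTime_lateChart Tlo r₀⟩

/-- **End-to-end check of the typed chain on the flat model**: the far label lines `u ↦ (u, r p)`,
`r ≥ R`, of Minkowski spacetime's late chart are future-directed timelike curves on `(T̲, ∞)` with
`η(γ̇, γ̇) ≤ -c₀` (`IsQuasiFinalTemporalChart.labelLine_isFutureTimelikeCurveOn` fed with the
inhabitants above), every `r₀ ≥ 0`, `T̲`. [cite: Ellithy2026, §4.1 p. 38; Def. 4.4 p. 39] -/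
theorem spacetime_labelLine_isFutureTimelikeCurveOn {r₀ : ℝ} (hr₀ : 0 ≤ r₀) (Tlo : ℝ) :
    ∃ R c₀ : ℝ, r₀ < R ∧ 0 < c₀ ∧ ∀ (r : ℝ) (p : sphere (0 : E3) 1), R ≤ r →
      spacetime.metric.IsFutureTimelikeCurveOn spacetime.timeOrientation
        (fun u : ℝ ↦ (lateChart (u, r, p) : spacetime.carrier)) (Ioi Tlo) ∧
      ∀ u : ℝ, Tlo < u →
        spacetime.metric.val (lateChart (u, r, p))
          (velocity (𝓡 4) (fun u : ℝ ↦ (lateChart (u, r, p) : spacetime.carrier)) u)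
          (velocity (𝓡 4) (fun u : ℝ ↦ (lateChart (u, r, p) : spacetime.carrier)) u) ≤ -c₀ :=
by
  have hT := spacetime_isQuasiFinalTemporalChart Tlo r₀
  exact hT.labelLine_isFutureTimelikeCurveOn (mod_cast le_top) (spacetime_hasADMForm hr₀ Tlo)
    (flat_isTailCoeff hr₀ (1 / 2) (3 / 4) Tlo) hr₀ (by norm_num)

/-! ### Development level: the genuine Cauchy development `Minkowski.vacuumCauchyDevelopment` -/

/-- The spacetime of the tree's Minkowski vacuum Cauchy development is `Minkowski.spacetime` (`rfl`;
restated at the `CauchyDevelopment` projection used below). [cite: ONeillSemiRiemannian1983, Ch. 14, Def. 14.28 (p. 415)] -/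
theorem vacuumCauchyDevelopment_toCauchyDevelopment_toSpacetime :
    vacuumCauchyDevelopment.toCauchyDevelopment.toSpacetime = spacetime := rfl

/-- **Def. 4.4 (1)+(2) with the §4.1 rest frame, at the development level**: the late chart of the
Cauchy development `𝒟₀ := Minkowski.vacuumCauchyDevelopment` satisfies `IsQuasiFinalAnalytic` in the
signature `(𝓡 4) (M := 𝒟₀.carrier) 𝒟₀.metric.val`, every `r₀ > 0`, `T̲`.
[cite: Ellithy2026, Def. 4.4 p. 39] -/
theorem dev_isQuasiFinalAnalytic {r₀ : ℝ} (hr₀ : 0 < r₀) (Tlo : ℝ) :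
    IsQuasiFinalAnalytic (𝓡 4) (M := vacuumCauchyDevelopment.toCauchyDevelopment.carrier)
      vacuumCauchyDevelopment.toCauchyDevelopment.metric.val lateChart Tlo r₀ :=
  spacetime_isQuasiFinalAnalytic hr₀ Tlo

/-- **The collar sentence of Def. 4.4 (1) at the development level** (`HasUniformCollarControl` over
`𝒟₀ := Minkowski.vacuumCauchyDevelopment`), every `r₀ > 0`, `T̲`. [cite: Ellithy2026, Def. 4.4 p. 39] -/
theorem dev_hasUniformCollarControl {r₀ : ℝ} (hr₀ : 0 < r₀) (Tlo : ℝ) :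
    HasUniformCollarControl (𝓡 4) (M := vacuumCauchyDevelopment.toCauchyDevelopment.carrier)
      vacuumCauchyDevelopment.toCauchyDevelopment.metric.val lateChart Tlo r₀ :=
  spacetime_hasUniformCollarControl hr₀ Tlo

/-- **Def. 4.4 (1)+(2), §4.1 rest frame and the collar sentence together, at the development level**
(`IsQuasiFinalAnalyticCollar` over `𝒟₀ := Minkowski.vacuumCauchyDevelopment`), every `r₀ > 0`, `T̲`.
[cite: Ellithy2026, Def. 4.4 p. 39] -/
theorem dev_isQuasiFinalAnalyticCollar {r₀ : ℝ} (hr₀ : 0 < r₀) (Tlo : ℝ) :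
    IsQuasiFinalAnalyticCollar (𝓡 4) (M := vacuumCauchyDevelopment.toCauchyDevelopment.carrier)
      vacuumCauchyDevelopment.toCauchyDevelopment.metric.val lateChart Tlo r₀ :=
  spacetime_isQuasiFinalAnalyticCollar hr₀ Tlo

/-- The ADM form (4.6) of the flat tuple for the development's metric in the late chart, `r₀ ≥ 0`.
[cite: Ellithy2026, Def. 4.4 (4.6) p. 39] -/
theorem dev_hasADMForm {r₀ : ℝ} (hr₀ : 0 ≤ r₀) (Tlo : ℝ) :
    HasADMForm (𝓡 4) (M := vacuumCauchyDevelopment.toCauchyDevelopment.carrier)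
      vacuumCauchyDevelopment.toCauchyDevelopment.metric.val lateChart Tlo r₀ TailClassModel.flat :=
  spacetime_hasADMForm hr₀ Tlo

/-- **The §4.1 orientation clause at the development level**: the late chart's time is the Cauchy
temporal function `t*` of `𝒟₀ := Minkowski.vacuumCauchyDevelopment` (`IsQuasiFinalTemporalChart` in the
signature `𝒟₀.metric 𝒟₀.timeOrientation`), every `T̲`, `r₀`. [cite: Ellithy2026, §4.1 p. 38] -/
theorem dev_isQuasiFinalTemporalChart (Tlo r₀ : ℝ) :
    IsQuasiFinalTemporalChart vacuumCauchyDevelopment.toCauchyDevelopment.metric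
      vacuumCauchyDevelopment.toCauchyDevelopment.timeOrientation E4.time lateChart Tlo r₀ :=
  spacetime_isQuasiFinalTemporalChart Tlo r₀

/-- Every level `{t* = c}` is a Cauchy hypersurface of the development `𝒟₀ :=
Minkowski.vacuumCauchyDevelopment` (O'Neill: "In `ℝⁿ₁` the hyperplanes `t` constant are Cauchy
hypersurfaces"). [cite: ONeillSemiRiemannian1983, Ch. 14, Def. 14.28 (p. 415)] -/
theorem dev_isCauchyHypersurface_level_time (c : ℝ) :
    vacuumCauchyDevelopment.toCauchyDevelopment.metric.IsCauchyHypersurface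
      vacuumCauchyDevelopment.toCauchyDevelopment.timeOrientation (E4.time ⁻¹' {c}) :=
  isCauchyHypersurface_level_time c

/-- **End-to-end at the development level**: the far label lines `u ↦ (u, r p)`, `r ≥ R`, of the late
chart are future-directed timelike curves for `𝒟₀.timeOrientation` on `(T̲, ∞)` with `η(γ̇, γ̇) ≤ -c₀`,
`𝒟₀ := Minkowski.vacuumCauchyDevelopment`, every `r₀ ≥ 0`, `T̲`.
[cite: Ellithy2026, §4.1 p. 38; Def. 4.4 p. 39] -/
theorem dev_labelLine_isFutureTimelikeCurveOn {r₀ : ℝ} (hr₀ : 0 ≤ r₀) (Tlo : ℝ) :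
    ∃ R c₀ : ℝ, r₀ < R ∧ 0 < c₀ ∧ ∀ (r : ℝ) (p : sphere (0 : E3) 1), R ≤ r →
      vacuumCauchyDevelopment.toCauchyDevelopment.metric.IsFutureTimelikeCurveOn
        vacuumCauchyDevelopment.toCauchyDevelopment.timeOrientation
        (fun u : ℝ ↦ (lateChart (u, r, p) : vacuumCauchyDevelopment.toCauchyDevelopment.carrier))
        (Ioi Tlo) ∧
      ∀ u : ℝ, Tlo < u →
        vacuumCauchyDevelopment.toCauchyDevelopment.metric.val (lateChart (u, r, p))
          (velocity (𝓡 4)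
            (fun u : ℝ ↦ (lateChart (u, r, p) : vacuumCauchyDevelopment.toCauchyDevelopment.carrier)) u)
          (velocity (𝓡 4)
            (fun u : ℝ ↦ (lateChart (u, r, p) : vacuumCauchyDevelopment.toCauchyDevelopment.carrier)) u)
        ≤ -c₀ :=
  spacetime_labelLine_isFutureTimelikeCurveOn hr₀ Tlo

end Minkowski

end Literature.Geometry.Lorentzian

end
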